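import Summits.SmoothPoincare4.SmoothPoincare4.Theorems.SullivanDualWitnessChargeDefs
import Summits.SmoothPoincare4.SmoothPoincare4.Theorems.SullivanDualWitnessChargeFlatChart
import Mathlib.Analysis.Convex.Topology
import Mathlib.Analysis.Complex.Convex

/-!
# The continuity method (CONT)

Crux `WitnessCharge` (stmt-SmoothPoincare4-7824), line `Sketch`, skeleton v7, stub `helper_continuityMethod`.

Bookkeeping of the continuity method for Gromov's pencil of `J`-planes over the half-planes
`H_s = {b : ℂ | s < re b}` of intercepts. A FAMILY over `X ⊆ ℂ` (the three conjuncts written out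
in the registered statements; an opaque local predicate `Fam X F` inside the proof) is a map
`F : ℂ → ℂ → Σ∖p` with `F b` a pencil member of intercept `b` for `b ∈ X`, `(b, ξ) ↦ F b ξ` of class
`C^∞` on `X × ℂ` with injective differential there. From the four statement-hypotheses — a far
family (FARFAM), far members are the far flat lines (FARU), uniqueness of continuous families on
preconnected open domains (UNIQ), and the one-step extension `H_s ⇒ H_{s-η}` unless `CurveAway`
(STEP) — we conclude: `CurveAway`, or a family over all of `ℂ`.

* (U) Two families over `H_s`, `H_t` agree on `H_{max s t}`: this set is open and convex, hence
  preconnected, and both families agree at the far real intercept `r = |s| + |t| + ε'⁻¹ + 1`, because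
  two members of one far intercept coincide as maps (FARU puts all their values in the punctured
  chart-ball with the same flat coordinates `(ξ, b)`, and `Ycoord p` is injective there by the flat
  chart `substub_flatChart`/`flatInv_Ycoord`); UNIQ concludes.
* Families patch (`hlocal`): a map which near every point of `X` agrees with a family over an open
  neighbourhood is a family over `X` (the three clauses are local:
  `ContMDiffAt.congr_of_eventuallyEq`, `Filter.EventuallyEq.mfderiv_eq`).
* The set `𝓢` of levels `s` carrying a family over `H_s` contains `ε'⁻¹ + 1` (restrict FARFAM, as
  `re b ≤ ‖b‖`), is an upper set (restriction), is pushed down by STEP, and is closed under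
  decreasing limits `a = inf (a + 1/(k+1))`: the families `F_k` over `H_{a + 1/(k+1)}` pairwise agree
  on overlaps by (U), so `b ↦ F_{⌈1/(re b - a)⌉₊} b` is a family over `H_a` by patching. Hence
  `𝓢 = ℝ` (otherwise `inf 𝓢 ∈ 𝓢` by the limit property and STEP pushes below the infimum).
* Finally `b ↦ F_{re b - 1} b`, for chosen families `F_s` over `H_s`, is a family over `ℂ` by (U) and
  patching.
-/

noncomputable section

set_option linter.dupNamespace false

open scoped Manifold ContDiff Topology
open Set Filter Literature.Geometry.Kaehler Literature.Geometry.Symplectic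
  Literature.Topology.FourManifolds

namespace Summit.SmoothPoincare4.SmoothPoincare4.Theorems.WitnessCharge.PencilIncompleteness

section FarUniqueness

variable {S : HomotopySphere 4} {p : S.carrier}
  {J : ∀ x : punctured p, TangentSpace (𝓡 4) x →L[ℝ] TangentSpace (𝓡 4) x}

/-- The complex flat coordinates `Ycoord p` are injective on the punctured `ε'`-chart-ball (the flat
chart has the left inverse `χ`, `flatInv_Ycoord`). -/
theorem continuityMethod_eq_of_Ycoord_eq {ε' : ℝ} (hε' : 0 < ε')
    (hball : Metric.closedBall (extChartAt (𝓡 4) p p) ε' ⊆ (extChartAt (𝓡 4) p).target)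
    {x y : punctured p} (hx : InPuncturedChartBall p ε' x) (hy : InPuncturedChartBall p ε' y)
    (h : Ycoord p x = Ycoord p y) : x = y := by
  obtain ⟨χ, hχ⟩ := exists_flatInv hε' hball
  calc x = χ (Ycoord p x) := (flatInv_Ycoord hε' hχ hx).symm
    _ = χ (Ycoord p y) := by rw [h]
    _ = y := flatInv_Ycoord hε' hχ hy

/-- FARU makes members of one far intercept unique: two members of intercept `b`, `‖b‖ > ε'⁻¹`,
coincide as maps (same flat coordinates `(ξ, b)` inside the chart-ball, where `Ycoord p` is
injective). -/
theorem continuityMethod_member_eq_of_far {ε' : ℝ} (hε' : 0 < ε')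
    (hball : Metric.closedBall (extChartAt (𝓡 4) p p) ε' ⊆ (extChartAt (𝓡 4) p).target)
    (hFar : ∀ (u : ℂ → punctured p) (b : ℂ), IsPencilMember J u b → ε'⁻¹ < ‖b‖ →
      ∀ ξ : ℂ, InPuncturedChartBall p ε' (u ξ) ∧ Ycoord p (u ξ) = (ξ, b))
    {u v : ℂ → punctured p} {b : ℂ} (hb : ε'⁻¹ < ‖b‖) (hu : IsPencilMember J u b)
    (hv : IsPencilMember J v b) : u = v := by
  funext ξ
  obtain ⟨hu1, hu2⟩ := hFar u b hu hb ξ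
  obtain ⟨hv1, hv2⟩ := hFar v b hv hb ξ
  exact continuityMethod_eq_of_Ycoord_eq hε' hball hu1 hv1 (hu2.trans hv2.symm)

/-- A far real intercept to the right of `max s t`: `r = |s| + |t| + ε'⁻¹ + 1`. -/
theorem continuityMethod_far_real {ε' : ℝ} (hε' : 0 < ε') (s t : ℝ) :
    ∃ r : ℝ, max s t < (r : ℂ).re ∧ ε'⁻¹ < ‖(r : ℂ)‖ := by
  have hi : 0 < ε'⁻¹ := inv_pos.2 hε'
  have hs := le_abs_self s
  have ht := le_abs_self t
  have hs' := abs_nonneg s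
  have ht' := abs_nonneg t
  refine ⟨|s| + |t| + ε'⁻¹ + 1, ?_, ?_⟩
  · rw [Complex.ofReal_re]
    exact max_lt (by linarith) (by linarith)
  · rw [Complex.norm_real, Real.norm_of_nonneg (by linarith)]
    linarith

end FarUniqueness

/-- **Classical stub CONT — the continuity method** (from FARFAM, FARU, UNIQ, STEP): unless
`CurveAway`, there is a GLOBAL smooth family of members with injective differential over all of
`ℂ`. Two families over half-planes `{s < re b}`, `{t < re b}` agree on the intersection (U): it is
open and convex, they agree at the far real intercept `|s| + |t| + ε'⁻¹ + 1` (FARU: members of one far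
intercept coincide, `Ycoord p` being injective on the chart-ball), so UNIQ applies. The set `𝓢` of
levels `s` carrying a family over `{s < re b}` contains `ε'⁻¹ + 1` (restricted far family, as
`re b ≤ ‖b‖`), is an upper set, satisfies `s ∈ 𝓢 ⇒ s - η ∈ 𝓢` (STEP), and is closed under the
decreasing limits `a = inf (a + 1/(k+1))` (patch the families over `{a + 1/(k+1) < re b}`, which
agree on overlaps by (U), via `b ↦ F_{⌈1/(re b - a)⌉₊} b`); hence `𝓢 = ℝ` (else `inf 𝓢 ∈ 𝓢` and
STEP goes below the infimum), and `b ↦ F_{re b - 1} b` patches chosen families `F_s` to a family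
over `ℂ`. -/
theorem helper_continuityMethod :
    ∀ (S : HomotopySphere 4) (p : S.carrier)
      (J : ∀ x : punctured p, TangentSpace (𝓡 4) x →L[ℝ] TangentSpace (𝓡 4) x) (ε' : ℝ),
      0 < ε' →
      Metric.closedBall (extChartAt (𝓡 4) p p) ε' ⊆ (extChartAt (𝓡 4) p).target →
      (∀ x : punctured p, InPuncturedChartBall p ε' x →
        ∀ (v : TangentSpace (𝓡 4) x) (b : EuclideanSpace ℝ (Fin 4)),
          inner ℝ (fderiv ℝ inversion (extChartAt (𝓡 4) p x.1 - extChartAt (𝓡 4) p p)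
            (mfderiv (𝓡 4) 𝓘(ℝ, EuclideanSpace ℝ (Fin 4))
              (fun z : punctured p => extChartAt (𝓡 4) p z.1) x (J x v))) b
          = stdSymplecticForm (fderiv ℝ inversion (extChartAt (𝓡 4) p x.1 - extChartAt (𝓡 4) p p)
            (mfderiv (𝓡 4) 𝓘(ℝ, EuclideanSpace ℝ (Fin 4))
              (fun z : punctured p => extChartAt (𝓡 4) p z.1) x v)) b) →
      (∃ F : ℂ → ℂ → punctured p,
          ((∀ b ∈ {b : ℂ | ε'⁻¹ < ‖b‖}, IsPencilMember J (F b) b) ∧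
            ContMDiffOn 𝓘(ℝ, ℂ × ℂ) (𝓡 4) ∞ (fun q : ℂ × ℂ => F q.1 q.2) (({b : ℂ | ε'⁻¹ < ‖b‖}) ×ˢ (univ : Set ℂ)) ∧
            (∀ q : ℂ × ℂ, q.1 ∈ {b : ℂ | ε'⁻¹ < ‖b‖} →
              Function.Injective (mfderiv 𝓘(ℝ, ℂ × ℂ) (𝓡 4) (fun q : ℂ × ℂ => F q.1 q.2) q)))) →
      (∀ (u : ℂ → punctured p) (b : ℂ), IsPencilMember J u b → ε'⁻¹ < ‖b‖ →
        ∀ ξ : ℂ, InPuncturedChartBall p ε' (u ξ) ∧ Ycoord p (u ξ) = (ξ, b)) →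
      (∀ (D : Set ℂ) (F₁ F₂ : ℂ → ℂ → punctured p), IsOpen D → IsPreconnected D →
        (∀ b ∈ D, IsPencilMember J (F₁ b) b) → (∀ b ∈ D, IsPencilMember J (F₂ b) b) →
        ContinuousOn (fun q : ℂ × ℂ => F₁ q.1 q.2) (D ×ˢ (univ : Set ℂ)) →
        ContinuousOn (fun q : ℂ × ℂ => F₂ q.1 q.2) (D ×ˢ (univ : Set ℂ)) →
        (∃ b₀ ∈ D, F₁ b₀ = F₂ b₀) → ∀ b ∈ D, F₁ b = F₂ b) →
      (∀ (s : ℝ) (F : ℂ → ℂ → punctured p),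
        ((∀ b ∈ {b : ℂ | s < b.re}, IsPencilMember J (F b) b) ∧
          ContMDiffOn 𝓘(ℝ, ℂ × ℂ) (𝓡 4) ∞ (fun q : ℂ × ℂ => F q.1 q.2) (({b : ℂ | s < b.re}) ×ˢ (univ : Set ℂ)) ∧
          (∀ q : ℂ × ℂ, q.1 ∈ {b : ℂ | s < b.re} →
            Function.Injective (mfderiv 𝓘(ℝ, ℂ × ℂ) (𝓡 4) (fun q : ℂ × ℂ => F q.1 q.2) q))) →
        CurveAway S p J ∨ ∃ η : ℝ, 0 < η ∧ ∃ F' : ℂ → ℂ → punctured p,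
          ((∀ b ∈ {b : ℂ | s - η < b.re}, IsPencilMember J (F' b) b) ∧
            ContMDiffOn 𝓘(ℝ, ℂ × ℂ) (𝓡 4) ∞ (fun q : ℂ × ℂ => F' q.1 q.2) (({b : ℂ | s - η < b.re}) ×ˢ (univ : Set ℂ)) ∧
            (∀ q : ℂ × ℂ, q.1 ∈ {b : ℂ | s - η < b.re} →
              Function.Injective (mfderiv 𝓘(ℝ, ℂ × ℂ) (𝓡 4) (fun q : ℂ × ℂ => F' q.1 q.2) q)))) →
      CurveAway S p J ∨ ∃ F : ℂ → ℂ → punctured p,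
          ((∀ b ∈ (univ : Set ℂ), IsPencilMember J (F b) b) ∧
            ContMDiffOn 𝓘(ℝ, ℂ × ℂ) (𝓡 4) ∞ (fun q : ℂ × ℂ => F q.1 q.2) (((univ : Set ℂ)) ×ˢ (univ : Set ℂ)) ∧
            (∀ q : ℂ × ℂ, q.1 ∈ (univ : Set ℂ) →
              Function.Injective (mfderiv 𝓘(ℝ, ℂ × ℂ) (𝓡 4) (fun q : ℂ × ℂ => F q.1 q.2) q))) := by
  intro S p J ε' hε' hball _hJstd hFarFam hFar hUniq hStep
  classical
  by_cases hcurve : CurveAway S p J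
  · exact Or.inl hcurve
  refine Or.inr ?_
  -- FAMILIES over `X ⊆ ℂ` (the three conjuncts of the statement), as an opaque local predicate
  obtain ⟨Fam, hFam⟩ : ∃ Fam : Set ℂ → (ℂ → ℂ → punctured p) → Prop,
      ∀ (X : Set ℂ) (F : ℂ → ℂ → punctured p), Fam X F ↔
        ((∀ b ∈ X, IsPencilMember J (F b) b) ∧
          ContMDiffOn 𝓘(ℝ, ℂ × ℂ) (𝓡 4) ∞ (fun q : ℂ × ℂ => F q.1 q.2) (X ×ˢ (univ : Set ℂ)) ∧
          (∀ q : ℂ × ℂ, q.1 ∈ X →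
            Function.Injective (mfderiv 𝓘(ℝ, ℂ × ℂ) (𝓡 4) (fun q : ℂ × ℂ => F q.1 q.2) q))) :=
    ⟨_, fun _ _ => Iff.rfl⟩
  -- restriction of families
  have hmono : ∀ {X Y : Set ℂ} {F : ℂ → ℂ → punctured p}, Fam Y F → X ⊆ Y → Fam X F := by
    intro X Y F h hXY
    rw [hFam] at h
    rw [hFam]
    exact ⟨fun b hb => h.1 b (hXY hb), h.2.1.mono (Set.prod_mono hXY Subset.rfl),
      fun q hq => h.2.2 q (hXY hq)⟩
  -- PATCHING: a map agreeing near every intercept of `X` with a family over an open neighbourhood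
  -- is a family over `X` (membership is pointwise; smoothness and injectivity of the differential of
  -- the total map are local on the open sets `W × ℂ`)
  have hlocal : ∀ {X : Set ℂ} {G : ℂ → ℂ → punctured p},
      (∀ b₀ ∈ X, ∃ W : Set ℂ, IsOpen W ∧ b₀ ∈ W ∧
        ∃ F : ℂ → ℂ → punctured p, Fam W F ∧ ∀ b ∈ W, G b = F b) → Fam X G := by
    intro X G h
    -- near a point over `W` the total maps of `G` and `F` agree eventually
    have key : ∀ (W : Set ℂ) (F : ℂ → ℂ → punctured p), IsOpen W → (∀ b ∈ W, G b = F b) →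
        ∀ q : ℂ × ℂ, q.1 ∈ W → W ×ˢ (univ : Set ℂ) ∈ 𝓝 q ∧
          (fun q : ℂ × ℂ => G q.1 q.2) =ᶠ[𝓝 q] (fun q : ℂ × ℂ => F q.1 q.2) := by
      intro W F hW hGF q hq
      have hn : W ×ˢ (univ : Set ℂ) ∈ 𝓝 q := (hW.prod isOpen_univ).mem_nhds ⟨hq, mem_univ _⟩
      refine ⟨hn, ?_⟩
      filter_upwards [hn] with r hr
      rw [hGF r.1 hr.1]
    rw [hFam]
    refine ⟨fun b hb => ?_, fun q hq => ?_, fun q hq => ?_⟩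
    · obtain ⟨W, -, hbW, F, hF, hGF⟩ := h b hb
      rw [hGF b hbW]
      exact ((hFam W F).1 hF).1 b hbW
    · obtain ⟨W, hW, hbW, F, hF, hGF⟩ := h q.1 hq.1
      obtain ⟨hn, heq⟩ := key W F hW hGF q hbW
      exact ((((hFam W F).1 hF).2.1.contMDiffAt hn).congr_of_eventuallyEq heq).contMDiffWithinAt
    · obtain ⟨W, hW, hbW, F, hF, hGF⟩ := h q.1 hq
      obtain ⟨-, heq⟩ := key W F hW hGF q hbW
      rw [Filter.EventuallyEq.mfderiv_eq (I := 𝓘(ℝ, ℂ × ℂ)) (I' := 𝓡 4) heq]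
      exact ((hFam W F).1 hF).2.2 q hbW
  -- the half-planes `{s < re b}` are open
  have hopen : ∀ s : ℝ, IsOpen {b : ℂ | s < b.re} := fun s =>
    isOpen_lt continuous_const Complex.continuous_re
  -- (U): two families over half-planes agree on the common half-plane
  have hU : ∀ (s t : ℝ) (F₁ F₂ : ℂ → ℂ → punctured p),
      Fam {b : ℂ | s < b.re} F₁ → Fam {b : ℂ | t < b.re} F₂ →
      ∀ b : ℂ, max s t < b.re → F₁ b = F₂ b := by
    intro s t F₁ F₂ h₁ h₂
    have hDs : {b : ℂ | max s t < b.re} ⊆ {b : ℂ | s < b.re} := fun b hb =>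
      lt_of_le_of_lt (le_max_left s t) hb
    have hDt : {b : ℂ | max s t < b.re} ⊆ {b : ℂ | t < b.re} := fun b hb =>
      lt_of_le_of_lt (le_max_right s t) hb
    obtain ⟨r, hr, hrn⟩ := continuityMethod_far_real hε' s t
    have h₁' := (hFam _ _).1 (hmono h₁ hDs)
    have h₂' := (hFam _ _).1 (hmono h₂ hDt)
    exact hUniq {b : ℂ | max s t < b.re} F₁ F₂ (hopen _)
      (convex_halfSpace_re_gt _).isPreconnected h₁'.1 h₂'.1 h₁'.2.1.continuousOn
      h₂'.2.1.continuousOn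
      ⟨(r : ℂ), hr, continuityMethod_member_eq_of_far hε' hball hFar hrn
        (h₁'.1 (r : ℂ) hr) (h₂'.1 (r : ℂ) hr)⟩
  -- (i) the far family restricts to a family over `{ε'⁻¹ + 1 < re b}`
  have hs₀ : ∃ F : ℂ → ℂ → punctured p, Fam {b : ℂ | ε'⁻¹ + 1 < b.re} F := by
    obtain ⟨Ffar, hFfar⟩ := hFarFam
    refine ⟨Ffar, hmono ((hFam _ _).2 hFfar) fun b hb => ?_⟩
    have hb' : ε'⁻¹ + 1 < b.re := hb
    show ε'⁻¹ < ‖b‖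
    exact lt_of_lt_of_le (by linarith) (Complex.re_le_norm b)
  -- (ii) upper set
  have hupper : ∀ s s' : ℝ, s ≤ s' →
      (∃ F : ℂ → ℂ → punctured p, Fam {b : ℂ | s < b.re} F) →
      ∃ F : ℂ → ℂ → punctured p, Fam {b : ℂ | s' < b.re} F := by
    rintro s s' hss' ⟨F, hF⟩
    exact ⟨F, hmono hF fun b hb => lt_of_le_of_lt hss' hb⟩
  -- (iii) STEP pushes the level down
  have hstep : ∀ s : ℝ, (∃ F : ℂ → ℂ → punctured p, Fam {b : ℂ | s < b.re} F) →
      ∃ η : ℝ, 0 < η ∧ ∃ F : ℂ → ℂ → punctured p, Fam {b : ℂ | s - η < b.re} F := by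
    rintro s ⟨F, hF⟩
    obtain ⟨η, hη, F', hF'⟩ := (hStep s F ((hFam _ _).1 hF)).resolve_left hcurve
    exact ⟨η, hη, F', (hFam _ _).2 hF'⟩
  -- (iv) closed under decreasing limits: patch the families over `{a + 1/(k+1) < re b}`
  have hlim : ∀ a : ℝ,
      (∀ k : ℕ, ∃ F : ℂ → ℂ → punctured p, Fam {b : ℂ | a + 1 / ((k : ℝ) + 1) < b.re} F) →
      ∃ F : ℂ → ℂ → punctured p, Fam {b : ℂ | a < b.re} F := by
    intro a hk
    choose Fk hFk using hk
    -- the selector `b ↦ ⌈1/(re b - a)⌉₊`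
    have hsel : ∀ b : ℂ, a < b.re → a + 1 / ((⌈1 / (b.re - a)⌉₊ : ℝ) + 1) < b.re := by
      intro b hb
      have hd : 0 < b.re - a := sub_pos.2 hb
      have h1 : 1 / (b.re - a) < (⌈1 / (b.re - a)⌉₊ : ℝ) + 1 :=
        (Nat.le_ceil _).trans_lt (lt_add_one _)
      have h2 : 1 / ((⌈1 / (b.re - a)⌉₊ : ℝ) + 1) < b.re - a :=
        (one_div_lt (by positivity) hd).2 h1
      linarith
    refine ⟨fun b => Fk ⌈1 / (b.re - a)⌉₊ b, hlocal fun b₀ hb₀ => ?_⟩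
    refine ⟨{b : ℂ | a + 1 / ((⌈1 / (b₀.re - a)⌉₊ : ℝ) + 1) < b.re},
      hopen _, hsel b₀ hb₀, Fk ⌈1 / (b₀.re - a)⌉₊, hFk _,
      fun b hb => ?_⟩
    have hb' : a + 1 / ((⌈1 / (b₀.re - a)⌉₊ : ℝ) + 1) < b.re := hb
    have hab : a < b.re := lt_trans (lt_add_of_pos_right a Nat.one_div_pos_of_nat) hb'
    exact hU _ _ _ _ (hFk _) (hFk _) b (max_lt (hsel b hab) hb')
  -- (v) every level carries a family
  have hall : ∀ t : ℝ, ∃ F : ℂ → ℂ → punctured p, Fam {b : ℂ | t < b.re} F := by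
    intro t
    by_contra ht
    obtain ⟨𝓢, h𝓢⟩ : ∃ 𝓢 : Set ℝ,
        𝓢 = {s | ∃ F : ℂ → ℂ → punctured p, Fam {b : ℂ | s < b.re} F} := ⟨_, rfl⟩
    have hmem : ∀ s : ℝ,
        s ∈ 𝓢 ↔ ∃ F : ℂ → ℂ → punctured p, Fam {b : ℂ | s < b.re} F := by
      intro s
      rw [h𝓢, Set.mem_setOf_eq]
    have hbdd : BddBelow 𝓢 :=
      ⟨t, fun s hs => not_lt.1 fun hst => ht (hupper s t hst.le ((hmem s).1 hs))⟩
    have hne : 𝓢.Nonempty := ⟨ε'⁻¹ + 1, (hmem _).2 hs₀⟩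
    have hak : ∀ k : ℕ, ∃ F : ℂ → ℂ → punctured p,
        Fam {b : ℂ | sInf 𝓢 + 1 / ((k : ℝ) + 1) < b.re} F := by
      intro k
      obtain ⟨s, hs, hslt⟩ :=
        exists_lt_of_csInf_lt hne (lt_add_of_pos_right (sInf 𝓢) Nat.one_div_pos_of_nat)
      exact hupper s _ hslt.le ((hmem s).1 hs)
    obtain ⟨η, hη, hη𝓢⟩ := hstep _ (hlim _ hak)
    have hmem' : sInf 𝓢 - η ∈ 𝓢 := (hmem _).2 hη𝓢
    have hle : sInf 𝓢 ≤ sInf 𝓢 - η := csInf_le hbdd hmem'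
    linarith
  -- (vi) patch chosen families over `{re b - 1 < re b'}` to a global family
  choose Fs hFs using hall
  have hG : Fam (univ : Set ℂ) (fun b => Fs (b.re - 1) b) := by
    refine hlocal fun b₀ _ => ?_
    refine ⟨{b : ℂ | b₀.re - 1 < b.re}, hopen _,
      show b₀.re - 1 < b₀.re by linarith, Fs (b₀.re - 1), hFs _, fun b hb => ?_⟩
    have hb' : b₀.re - 1 < b.re := hb
    exact hU _ _ _ _ (hFs _) (hFs _) b (max_lt (by linarith) hb')
  exact ⟨fun b => Fs (b.re - 1) b, (hFam _ _).1 hG⟩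

end Summit.SmoothPoincare4.SmoothPoincare4.Theorems.WitnessCharge.PencilIncompleteness
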